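import Summits.BirchSwinnertonDyer.BirchSwinnertonDyer.Theorems.ByReductionTypeAtTwoOrdKatoHalfAtTwoIsoSignFreeDefs
import Summits.BirchSwinnertonDyer.BirchSwinnertonDyer.Theorems.TwoAdicConverseOrdLambdaHalfAtTwoThetaMuTransport
import HarnessLib

/-!
# Route ByReductionTypeAtTwo, crux `OrdKatoHalfAtTwoIso` (stmt-BirchSwinnertonDyer-19573), line
# `steinberg-fibre-at-two`, child F1μ⁺ `OrdKatoFineZetaAtTwoResidue` (stmt-BirchSwinnertonDyer-23959): the `μ`-chain with an
# `ι`-SEMILINEAR column map — the reading `HasZetaColemanMuInputsAtTwo` asks for a `Λ`-LINEAR `τ : P → X(E/ℚ_∞)` after a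
# `Λ`-linear `ℓ : 𝐇¹ → P`, but Kato's Poitou–Tate map from the `γ`-pinned `𝐇¹_loc` into the tree's Pontryagin dual `D.X`
# (`SelmerDualData`: `(T·x)(s) = x((conj_γ − 1) s)`) is `ι`-semilinear (`T ↦ (1+T)⁻¹ − 1`); this file proves the whole
# kernel chain «reading ⇒ μ(X(E/ℚ_∞)) = 0 ⇒ Kato's `μ`-part ⇒ lower divisibility at `W` ⇒ B8 / the residue binder / the
# crux BY NAME» for a `θ`-SEMILINEAR `τ`, `θ` ANY ring automorphism of `Λ` (`θ = 1`: the filed reading; `θ = ι`: print)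

Seat `cruxlead-stmt-BirchSwinnertonDyer-19573-w3` g2 (prover WIDTH under the LEAD `cruxlead-19573` g5; HOME
`run/shared/lean/pub/bsd-2adic/`; `--supports` stmt-BirchSwinnertonDyer-23959). HONEST FRAMING (cell bsd-2adic): BSD is not
proved by any of this; F1μ⁺, CoreA⁺, B7 and the crux are NOT proved here; every theorem is a KERNEL implication over explicit
hypotheses (no definition, no named fact, no `sorry`).

THE FINDING (w3 g2; the crux-202 instance of the pen's Δ19-2 / RC-373 (1) ruling «R-b» for crux 19556). In the tree, BOTH
Kato's global `𝐇¹_Γ(T₂W)` (`Kato2004.IwasawaH1Data.proj_T_smul`: `T = conj_γ − 1`) and its local companion `𝐇¹_{loc,Γ}`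
(`LocalIwasawaH1Data`) carry the natural `Λ`-structure, while the Selmer dual `D : W.SelmerDualData κ γ` carries the
PRECOMPOSITION structure `(T·x)(s) = x(conj_γ s) − x(s)`. The local Tate pairing is Galois-EQUIVARIANT,
`⟨conj_g y, g·Q⟩ = ⟨y, Q⟩` (tree: (P2) `pair n (g̃ · y) (g • Q) = pair n y Q`, `…ThetaPartnerAtTwoSignedKatoUpToAtTwoLayerPairingCompat`),
hence `⟨(γ − 1) y, s⟩ = ⟨y, (γ⁻¹ − 1) s⟩`: the pairing-induced map `𝐇¹_loc ⧸ 𝐇¹_loc(F⁺) → D.X`, `u ↦ ⟨u, loc₂ ·⟩`, sends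
`T·u` to `((1+T)⁻¹ − 1)·⟨u, loc₂ ·⟩`, i.e. it is `ι`-SEMILINEAR for the Iwasawa involution `ι = IwasawaAlgebra.invol`
(`T ↦ (1+T)⁻¹ − 1`). So the honest instance of the filed reading's `(P, ℓ, τ)` is `P = 𝔏(𝐇¹_loc ⧸ 𝐇¹_loc(F⁺))` (Prop. 17.11),
`ℓ = 𝔏 ∘ loc₂` (`Λ`-linear) and `τ` `ι`-SEMILINEAR — not `Λ`-linear as `HasZetaColemanMuInputsAtTwo` (p678187), hence child
23959, and likewise `Kato2004.DivisibilityInputs.toX` (odd `p`) demand; forcing linearity «would hide the involution in a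
definition» (RC-373 (1)(i)). Nothing downstream needs linearity: `μ` is blind to the keying (p686294's twin
`TwoAdicKatoDeterminant.muInvariant_eq_of_semilinear_bijective`; local lengths at the `θ`-fixed point `(2)`,
`lengthAt_eq_of_semilinear_ringEquiv_of_asIdeal_eq_augIdealP`). This file re-proves the line's `μ`-bookkeeping for a
`θ`-semilinear `τ` (this file, per datum); the sequel `…ZetaColemanMuIotaChain.lean` re-threads the ∀-forms and the whole
door chain to the crux BY NAME, so that an `ι`-aware re-cut of the F1 child («F1μ⁺ι»: the body of
`ZetaColemanMuInputsAtTwo` with `∃ θ : Λ ≃+* Λ` and `τ : P →ₛₗ[θ] D.X`) is closable by name exactly like F1μ⁺, and is IMPLIED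
by F1μ⁺ (`θ = 1`) — the lead's/pen's call.

* §1 `lengthAt_eq_zero_of_range_semilinear` — for `f : A →ₛₗ[θ] X` and a submodule `K = range f` (as a set):
  `length_(2) A = 0 ⇒ length_(2) K = 0` (`A ⧸ ker f ≃ K` `θ`-semilinearly; transport at the `θ`-fixed point `(2)`).
* §2 `mu_eq_zero_of_zetaColemanMuIota_of_coreW` — per datum: the reading with `τ : P →ₛₗ[θ] D.X` and the core Theorem A at `2`
  FOR THIS `W` (hypothesis in the shape socket 1 / CoreA⁺ deliver) ⇒ `μ(D.X) = 0`; wrappers `…_of_negDisc` (`Δ < 0`: socket 1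
  is the THEOREM p669276) and `…_of_coreTheoremAPosDiscTwo` (sign-free: + the `0 < Δ` binder by name, lead p684479).

References: [Kato2004Asterisque] Thm 12.6 (p. 222), (14.9.3) (p. 240), Thm 16.6 (p. 271), Prop 17.11 (p. 277), §17.13
(pp. 279–280); [MazurTateTeitelbaum1986Invent] §I.17 (the involution); [GreenbergLNM1716] §1 p. 60 (the two `Λ`-structures on
a Pontryagin dual), Conj. 1.11; [Washington1997] §13.2; [BourbakiAC5to7] VII §4.4; [MilneADT2006] I Cor. 2.3 (equivariance of
the local pairing); [AbbesUllmo1996] Thm A; tree p655368, p669276, p678187, p682177, p682426, p684479, p686294, HOME RC-373 (1).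
-/

set_option autoImplicit false
set_option linter.dupNamespace false

noncomputable section

open scoped Classical MatrixGroups ModularForm NumberField
open CongruenceSubgroup WeierstrassCurve Field IsDedekindDomain NumberField
open Literature.NumberTheory.GaloisRepresentations
open Literature.NumberTheory.GaloisCohomology
open Literature.NumberTheory.EllipticCurves Literature.NumberTheory.EllipticCurves.ModularForms
open Literature.NumberTheory.EllipticCurves.Kato2004
  Literature.NumberTheory.EllipticCurves.Kato2004.EulerSystemValues
open Literature.NumberTheory.EllipticCurves.Rank1Residual
open Literature.NumberTheory.EllipticCurves.Greenberg1999
open Summit.BirchSwinnertonDyer.BirchSwinnertonDyer.Theorems.Rank1ResidualX1Defs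
  Summit.BirchSwinnertonDyer.BirchSwinnertonDyer.Rank1Residual
  Summit.BirchSwinnertonDyer.BirchSwinnertonDyer.Rank1Residual.CoreAssembly
open Summit.BirchSwinnertonDyer.Rank1Residual Summit.BirchSwinnertonDyer.Rank1Residual.X5
open Summit.BirchSwinnertonDyer.BirchSwinnertonDyer.Theorems.OrdKatoOptimalAtTwo
  Summit.BirchSwinnertonDyer.BirchSwinnertonDyer.Theorems.OrdKatoIntAtTwo
open Summit.BirchSwinnertonDyer.BirchSwinnertonDyer.Theses.ByReductionTypeAtTwo

namespace Summit.BirchSwinnertonDyer.BirchSwinnertonDyer.Theorems.SteinbergFibreAtTwo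

/-! ## §1 Local length at `(2)` along a `θ`-semilinear map -/

section Semilinear

variable {p : ℕ} [Fact p.Prime]
  {A : Type*} [AddCommGroup A] [Module (IwasawaAlgebra p) A]
  {X : Type*} [AddCommGroup X] [Module (IwasawaAlgebra p) X]

/-- **The image of a module of local length `0` at `(p)` under a `θ`-semilinear map has local length `0` at `(p)`**, for
ANY ring automorphism `θ` of `Λ = ℤ_p⟦T⟧`: `f` induces a `θ`-semilinear additive bijection `A ⧸ ker f ≃ K` onto its range
`K` (a `Λ`-submodule, `θ` onto), local lengths are transported along it at the `θ`-FIXED point `(p)`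
(`TwoAdicKatoDeterminant.lengthAt_eq_of_semilinear_ringEquiv_of_asIdeal_eq_augIdealP`), and `length (A ⧸ ker f) ≤ length A`.
[cite: BourbakiAC5to7, Ch. VII §4.4] [cite: Washington1997, §13.2] -/
theorem lengthAt_eq_zero_of_range_semilinear (θ : IwasawaAlgebra p ≃+* IwasawaAlgebra p)
    (f : A →ₛₗ[(θ : IwasawaAlgebra p →+* IwasawaAlgebra p)] X) (K : Submodule (IwasawaAlgebra p) X)
    (hK : ∀ x, x ∈ K ↔ x ∈ Set.range f) (𝔓 : PrimeSpectrum (IwasawaAlgebra p))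
    (h𝔓 : 𝔓.asIdeal = IwasawaAlgebra.augIdealP p) (hA : Module.lengthAt (IwasawaAlgebra p) A 𝔓 = 0) :
    Module.lengthAt (IwasawaAlgebra p) K 𝔓 = 0 := by
  -- `A ⧸ ker f → K`, `θ`-semilinear, bijective
  let g : (A ⧸ LinearMap.ker f) →ₛₗ[(θ : IwasawaAlgebra p →+* IwasawaAlgebra p)] X :=
    (LinearMap.ker f).liftQ f le_rfl
  have hg_inj : Function.Injective g := by
    rw [← LinearMap.ker_eq_bot]
    exact Submodule.ker_liftQ_eq_bot _ _ _ le_rfl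
  have hg_mem : ∀ q, g q ∈ K := by
    intro q
    obtain ⟨a, rfl⟩ := Submodule.mkQ_surjective (LinearMap.ker f) q
    exact (hK _).2 ⟨a, (Submodule.liftQ_apply (LinearMap.ker f) f a).symm⟩
  let g' : (A ⧸ LinearMap.ker f) →+ K := g.toAddMonoidHom.codRestrict K.toAddSubgroup hg_mem
  have hg' : Function.Bijective g' := by
    refine ⟨fun x y h ↦ hg_inj (congrArg Subtype.val h), ?_⟩
    rintro ⟨x, hx⟩
    obtain ⟨a, rfl⟩ := (hK x).1 hx
    exact ⟨Submodule.Quotient.mk a, Subtype.ext (Submodule.liftQ_apply (LinearMap.ker f) f (h := le_rfl) a)⟩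
  let e : (A ⧸ LinearMap.ker f) ≃+ K := AddEquiv.ofBijective g' hg'
  have he : ∀ (r : IwasawaAlgebra p) (q : A ⧸ LinearMap.ker f), e (r • q) = θ r • e q := fun r q ↦
    Subtype.ext (g.map_smulₛₗ r q)
  rw [← TwoAdicKatoDeterminant.lengthAt_eq_of_semilinear_ringEquiv_of_asIdeal_eq_augIdealP θ e he 𝔓 h𝔓]
  exact le_antisymm (hA ▸ Module.lengthAt_quotient_le (LinearMap.ker f) 𝔓) bot_le

end Semilinear

/-! ## §2 Per datum: `μ(X(E/ℚ_∞)) = 0` from the reading with a SEMILINEAR column map -/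

section PerDatum

variable {W : WeierstrassCurve ℚ} [W.IsElliptic] [W.IsGloballyMinimal]
  [ContinuousSMul ℤ_[2] (W.tateModule 2)] [Module.Free ℤ_[2] (W.tateModule 2)]
  [Module.Finite ℤ_[2] (W.tateModule 2)] {N : ℕ} {f : CuspForm (Gamma0 N) 2}
  {κ : ZpExtension ℚ 2} {γ : absoluteGaloisGroup ℚ} {hκ : κ.IsCyclotomic}
  {D : W.SelmerDualData κ γ} {Y : W.FineSelmerDualData κ γ}

/-- **`μ(X(E/ℚ_∞)) = 0` from Kato's zeta classes in Coleman coordinates at `2` with a `θ`-SEMILINEAR column map, per datum.**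
Data/hypotheses (explicit; nothing asserted): `W` good ordinary at `2` with `ρ̄_{W,2}` onto, a newform `f`, a topological
generator `γ`; a ring automorphism `θ` of `Λ` (print: `θ = ι`; the filed reading: `θ = 1`); the pinned `𝐇¹` `I`, `Z ⊆ 𝐇¹` inside the
span of GENUINE `2`-adic Euler-system classes, an ideal `P ⊆ Λ`, a `Λ`-linear `ℓ : 𝐇¹ → P`, a `θ`-SEMILINEAR `τ : P → X(E/ℚ_∞)`
killing `ℓ(Z)` and exact before the fine quotient `π : X ↠ X₀`, the zeta image clause at `(2)`; and the core Theorem A at `2`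
FOR THIS `W` (`hcoreW`: a genuine class `∉ 2𝐇¹` kills the `E[2]`-lifts of `Sel₀(E/ℚ_∞)` by a power of `conj_γ − 1`). Chain as in
p678187/p682426: INT2-AUTO + socket 3 (PROVED) give `G₁ ∉ (2)`; the image clause gives a zeta class `∉ 2𝐇¹`, the span clause a
genuine one; `hcoreW` makes `X₀/2X₀` finite, so `length_(2) X₀ = 0`; `length_(2) (P ⧸ ℓZ) = 0` as `P ⧸ ℓZ ↪ Λ ⧸ ℓ(Z) ∋ s·G₁ ∉ (2)`;
NEW: `ker π = τ(P ⧸ ℓZ)` is the image of a length-`0` module under a `θ`-semilinear map, so `length_(2) ker π = 0` (§1), and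
`length_(2) X ≤ length_(2) ker π + length_(2) X₀ = 0`.
[cite: Kato2004Asterisque, Thm 12.6 (p. 222), (14.9.3) (p. 240), §17.13 (pp. 279–280)] [cite: Washington1997, §13.2]
[cite: GreenbergLNM1716, §1 p. 60 (the two Λ-structures on a Pontryagin dual)] -/
theorem mu_eq_zero_of_zetaColemanMuIota_of_coreW [NeZero N] (hgo : GoodOrd W 2)
    (h2 : W.HasSurjectiveModNGaloisRep 2) (hf : IsNewformOf W f) (hγ : κ.IsTopGenerator γ)
    (θ : IwasawaAlgebra 2 ≃+* IwasawaAlgebra 2)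
    (I : IwasawaH1Data W 2 κ γ) (Z : Submodule (IwasawaAlgebra 2) I.H)
    (P : Submodule (IwasawaAlgebra 2) (IwasawaAlgebra 2))
    (ℓ : I.H →ₗ[IwasawaAlgebra 2] P) (τ : P →ₛₗ[(θ : IwasawaAlgebra 2 →+* IwasawaAlgebra 2)] D.X)
    (π : D.X →ₗ[IwasawaAlgebra 2] Y.X)
    (hZ : Z ≤ Submodule.span (IwasawaAlgebra 2) {s : I.H | IsEulerSystemClassTwo W hκ I s})
    (hτℓ : ∀ z ∈ Z, τ (ℓ z) = 0) (hπs : Function.Surjective π) (hπ : Function.Exact τ π)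
    (himg : ∀ G₁ : IwasawaAlgebra 2,
      iwasawaToPowerSeries 2 G₁ = padicLFunction f (unitRoot W 2 : ℚ_[2]) →
        ∃ s : IwasawaAlgebra 2, s ∉ IwasawaAlgebra.augIdealP 2 ∧
          s * G₁ ∈ Submodule.map (P.subtype ∘ₗ ℓ) Z)
    (hcoreW : (∃ s : I.H, IsEulerSystemClassTwo W hκ I s ∧
        s ∉ IwasawaAlgebra.augIdealP 2 • (⊤ : Submodule (IwasawaAlgebra 2) I.H)) →
      ∃ J : ℕ, ∀ y : Literature.NumberTheory.EllipticCurves.subgroupH1 κ.kerSubgroup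
          (WeierstrassCurve.geomTorsion W (2 : ℤ)),
        W.torsionToPrimaryH1Sub 2 κ.kerSubgroup y ∈ W.fineSelmerInfty κ →
          (⇑(Literature.NumberTheory.EllipticCurves.conjH1 κ.kerSubgroup
              (WeierstrassCurve.geomTorsion W (2 : ℤ)) γ -
            AddMonoidHom.id (Literature.NumberTheory.EllipticCurves.subgroupH1 κ.kerSubgroup
              (WeierstrassCurve.geomTorsion W (2 : ℤ)))))^[J] y = 0) :
    D.mu = 0 := by
  have hord : IsOrdinaryAt W 2 := ⟨hgo.1, hgo.2⟩
  haveI : NeZero ((2 : ℕ) : ℚ) := ⟨by norm_num⟩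
  haveI : Module.Finite (IwasawaAlgebra 2) D.X :=
    WeierstrassCurve.SelmerDualData.module_finite_of_isCyclotomic W κ hκ D hγ
  haveI : Module.Finite (IwasawaAlgebra 2) Y.X := Module.Finite.of_surjective π hπs
  -- `L₂(f, α) ∈ ι(Λ)` (INT2-AUTO, PROVED) and socket 3 (PROVED): `G₁ ∉ (2)`
  obtain ⟨G₁, hG₁⟩ := exists_iwasawaToPowerSeries_eq_padicLFunction_two_auto (W := W) (f := f) hord hf
  have hμL : G₁ ∉ IwasawaAlgebra.augIdealP 2 :=
    not_mem_augIdealP_of_norm_coeff_eq_one hG₁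
      (AnalyticMuTwo.exists_norm_coeff_padicLFunction_two_eq_one_of_surj W hgo h2 hf)
  obtain ⟨s, hs, hsG⟩ := himg G₁ hG₁
  -- some zeta class `z ∈ Z` is not divisible by `2` in `𝐇¹`
  have hz : ∃ z ∈ Z, z ∉ IwasawaAlgebra.augIdealP 2 • (⊤ : Submodule (IwasawaAlgebra 2) I.H) := by
    by_contra hcon
    push Not at hcon
    have hZle : Z ≤ IwasawaAlgebra.augIdealP 2 • (⊤ : Submodule (IwasawaAlgebra 2) I.H) :=
      fun z hz => hcon z hz
    have hsub : Submodule.map (P.subtype ∘ₗ ℓ) Z ≤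
        (IwasawaAlgebra.augIdealP 2 • ⊤ : Submodule (IwasawaAlgebra 2) (IwasawaAlgebra 2)) :=
      (Submodule.map_mono hZle).trans
        (by rw [Submodule.map_smul'']; exact Submodule.smul_mono le_rfl le_top)
    have htop : (IwasawaAlgebra.augIdealP 2 • ⊤ : Submodule (IwasawaAlgebra 2) (IwasawaAlgebra 2)) =
        IwasawaAlgebra.augIdealP 2 := by
      rw [Ideal.smul_eq_mul, Ideal.mul_top]
    have hsG' : s * G₁ ∈ IwasawaAlgebra.augIdealP 2 := by rw [← htop]; exact hsub hsG
    rcases (IwasawaAlgebra.isPrime_augIdealP_holds 2).mem_or_mem hsG' with h' | h'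
    · exact hs h'
    · exact hμL h'
  obtain ⟨z, hzZ, hz2⟩ := hz
  -- hence a GENUINE `2`-adic Euler-system class not divisible by `2`
  obtain ⟨s', hs', hs'p⟩ := exists_mem_not_mem_of_le_span hZ hzZ hz2
  -- the core Theorem A at `2` for this `W`
  obtain ⟨J, hJ⟩ := hcoreW ⟨s', hs', hs'p⟩
  haveI : Finite (Y.X ⧸ (IwasawaAlgebra.augIdealP 2 • (⊤ : Submodule (IwasawaAlgebra 2) Y.X))) :=
    Y.finite_quotient_augIdealP_of_finite_pTorsion
      (W.finite_fineSelmerInfty_pTorsion_of_forall_iterate_eq_zero κ hγ hJ)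
  -- bookkeeping at `𝔭 = (2)`
  let 𝔭 : PrimeSpectrum (IwasawaAlgebra 2) :=
    ⟨IwasawaAlgebra.augIdealP 2, IwasawaAlgebra.isPrime_augIdealP_holds 2⟩
  have hY0 : Module.lengthAt (IwasawaAlgebra 2) Y.X 𝔭 = 0 :=
    KatoMuSkeleton.lengthAt_eq_zero_of_finite_quotient_p (M := Y.X) 𝔭 rfl
  have hX0 : Module.lengthAt (IwasawaAlgebra 2) D.X 𝔭 = 0 := by
    set LZ : Submodule (IwasawaAlgebra 2) P := Submodule.map ℓ Z with hLZ
    set M : Ideal (IwasawaAlgebra 2) := Submodule.map P.subtype LZ with hM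
    have hM_eq : Submodule.map (P.subtype ∘ₗ ℓ) Z = M := by
      rw [hM, hLZ, Submodule.map_comp]
    have hsGM : s * G₁ ∈ M := hM_eq ▸ hsG
    have hnot : ¬ M ≤ 𝔭.asIdeal := fun hle => by
      rcases 𝔭.isPrime.mem_or_mem (hle hsGM) with h' | h'
      · exact hs h'
      · exact hμL h'
    have hΛM : Module.lengthAt (IwasawaAlgebra 2) (IwasawaAlgebra 2 ⧸ M) 𝔭 = 0 :=
      Module.lengthAt_quotient_eq_zero_of_not_le hnot
    have hPLZ : Module.lengthAt (IwasawaAlgebra 2) (P ⧸ LZ) 𝔭 = 0 := by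
      refine le_antisymm ?_ bot_le
      rw [← hΛM]
      refine Module.lengthAt_le_of_injective (Submodule.mapQ LZ M P.subtype fun y hy => ⟨y, hy, rfl⟩) ?_ 𝔭
      rw [← LinearMap.ker_eq_bot, Submodule.ker_mapQ, hM,
        Submodule.comap_map_eq_of_injective P.injective_subtype, Submodule.mkQ_map_self]
    have hle : LZ ≤ LinearMap.ker τ := by
      rintro _ ⟨x, hx, rfl⟩
      exact hτℓ x hx
    -- NEW (semilinear step): `ker π = τ(P ⧸ LZ)` has local length `0` at `(2)`
    let f' : (P ⧸ LZ) →ₛₗ[(θ : IwasawaAlgebra 2 →+* IwasawaAlgebra 2)] D.X := LZ.liftQ τ hle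
    have hK : ∀ x, x ∈ LinearMap.ker π ↔ x ∈ Set.range f' := by
      intro x
      rw [LinearMap.mem_ker]
      constructor
      · intro hx
        obtain ⟨u, rfl⟩ := (hπ x).1 hx
        exact ⟨Submodule.Quotient.mk u, Submodule.liftQ_apply _ _ u⟩
      · rintro ⟨q, rfl⟩
        obtain ⟨u, rfl⟩ := Submodule.mkQ_surjective LZ q
        exact (hπ _).2 ⟨u, (Submodule.liftQ_apply _ _ u).symm⟩
    have hker : Module.lengthAt (IwasawaAlgebra 2) (LinearMap.ker π) 𝔭 = 0 :=
      lengthAt_eq_zero_of_range_semilinear θ f' (LinearMap.ker π) hK 𝔭 rfl hPLZ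
    refine le_antisymm ?_ bot_le
    calc Module.lengthAt (IwasawaAlgebra 2) D.X 𝔭
        ≤ Module.lengthAt (IwasawaAlgebra 2) (LinearMap.ker π) 𝔭 +
            Module.lengthAt (IwasawaAlgebra 2) Y.X 𝔭 :=
          Module.lengthAt_le_add_of_exact (LinearMap.ker π).subtype π (LinearMap.exact_subtype_ker_map π) 𝔭
      _ = 0 := by rw [hker, hY0, zero_add]
  change muInvariant 2 D.X = 0
  rw [muInvariant_eq_toNat_lengthAt 2 D.X 𝔭 rfl, hX0]
  rfl

/-- **`Δ < 0`: `μ(X(E/ℚ_∞)) = 0` from the reading with a `θ`-semilinear column map, per datum** — the core Theorem A at `2` on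
`Δ < 0` is the line's THEOREM `coreTheoremATwoResidue_holds` (p669276). [cite: Kato2004Asterisque, §17.13 (pp. 279–280)]
[cite: Washington1997, §13.2] -/
theorem mu_eq_zero_of_zetaColemanMuIota_of_negDisc [NeZero N] (hgo : GoodOrd W 2)
    (h2 : W.HasSurjectiveModNGaloisRep 2) (hΔ : W.Δ < 0) (hf : IsNewformOf W f) (hγ : κ.IsTopGenerator γ)
    (θ : IwasawaAlgebra 2 ≃+* IwasawaAlgebra 2)
    (I : IwasawaH1Data W 2 κ γ) (Z : Submodule (IwasawaAlgebra 2) I.H)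
    (P : Submodule (IwasawaAlgebra 2) (IwasawaAlgebra 2))
    (ℓ : I.H →ₗ[IwasawaAlgebra 2] P) (τ : P →ₛₗ[(θ : IwasawaAlgebra 2 →+* IwasawaAlgebra 2)] D.X)
    (π : D.X →ₗ[IwasawaAlgebra 2] Y.X)
    (hZ : Z ≤ Submodule.span (IwasawaAlgebra 2) {s : I.H | IsEulerSystemClassTwo W hκ I s})
    (hτℓ : ∀ z ∈ Z, τ (ℓ z) = 0) (hπs : Function.Surjective π) (hπ : Function.Exact τ π)
    (himg : ∀ G₁ : IwasawaAlgebra 2,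
      iwasawaToPowerSeries 2 G₁ = padicLFunction f (unitRoot W 2 : ℚ_[2]) →
        ∃ s : IwasawaAlgebra 2, s ∉ IwasawaAlgebra.augIdealP 2 ∧
          s * G₁ ∈ Submodule.map (P.subtype ∘ₗ ℓ) Z) :
    D.mu = 0 :=
  mu_eq_zero_of_zetaColemanMuIota_of_coreW hgo h2 hf hγ θ I Z P ℓ τ π hZ hτℓ hπs hπ himg
    (coreTheoremATwoResidue_holds W κ γ I hκ hgo.1 hgo.2 h2 hΔ hγ)

/-- **Sign-free: `μ(X(E/ℚ_∞)) = 0` from the reading with a `θ`-semilinear column map and the `0 < Δ` core binder CoreA⁺ BY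
NAME** (`core_signFree_of_coreTheoremAPosDiscTwo`, lead p684479), per datum. [cite: Kato2004Asterisque, §17.13 (pp. 279–280)]
[cite: MazurRubin2004, Prop. 1.3.2 and §5.3 (shape)] -/
theorem mu_eq_zero_of_zetaColemanMuIota_of_coreTheoremAPosDiscTwo [NeZero N] (hpos : CoreTheoremAPosDiscTwo)
    (hgo : GoodOrd W 2) (h2 : W.HasSurjectiveModNGaloisRep 2) (hf : IsNewformOf W f) (hγ : κ.IsTopGenerator γ)
    (θ : IwasawaAlgebra 2 ≃+* IwasawaAlgebra 2)
    (I : IwasawaH1Data W 2 κ γ) (Z : Submodule (IwasawaAlgebra 2) I.H)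
    (P : Submodule (IwasawaAlgebra 2) (IwasawaAlgebra 2))
    (ℓ : I.H →ₗ[IwasawaAlgebra 2] P) (τ : P →ₛₗ[(θ : IwasawaAlgebra 2 →+* IwasawaAlgebra 2)] D.X)
    (π : D.X →ₗ[IwasawaAlgebra 2] Y.X)
    (hZ : Z ≤ Submodule.span (IwasawaAlgebra 2) {s : I.H | IsEulerSystemClassTwo W hκ I s})
    (hτℓ : ∀ z ∈ Z, τ (ℓ z) = 0) (hπs : Function.Surjective π) (hπ : Function.Exact τ π)
    (himg : ∀ G₁ : IwasawaAlgebra 2,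
      iwasawaToPowerSeries 2 G₁ = padicLFunction f (unitRoot W 2 : ℚ_[2]) →
        ∃ s : IwasawaAlgebra 2, s ∉ IwasawaAlgebra.augIdealP 2 ∧
          s * G₁ ∈ Submodule.map (P.subtype ∘ₗ ℓ) Z) :
    D.mu = 0 :=
  mu_eq_zero_of_zetaColemanMuIota_of_coreW hgo h2 hf hγ θ I Z P ℓ τ π hZ hτℓ hπs hπ himg
    (core_signFree_of_coreTheoremAPosDiscTwo hpos W κ γ I hκ hgo.1 hgo.2 h2 hγ)

end PerDatum

end Summit.BirchSwinnertonDyer.BirchSwinnertonDyer.Theorems.SteinbergFibreAtTwo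

end
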